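/-
Origin: expansion seat `planner-pub-hodgecm-mc-theta-3-g12-0`, handover (SD) 2026-08-20T05:30:00Z md5 af9c930f66c613e1e50a06cc606ebf3f (170 l.; NEW additive leaf over installed K-1 `JunctionVacuumDefinite`/`JunctionVacuumOverlapPhase`/`RealUnitaryDualPairNegate` + `SchwartzCompactWeilDatum`; generic small Weil data on the slot group `Ginf P Q R S`: doubly-definite `exists_slotDatum_of_definite` (via `κEquiv : DPK ≃* Ginf`), (p,1)×(r,0) `exists_slotDatum_of_negCard` + `_swap`, dispatcher `exists_slotDatum_of_shape`; cert rc 0/12 s/0 warn/0 proof-hole; axioms 16/16 ⊆ trio) (`HOME/mc/pub-hodgecm-mc-theta-3-g12/lean/stage42/HodgeCM/Model/ArchSlotDatumDefinite.lean`, md5 af9c930f66c6, 170 lines);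
landed by the second packager p2 gen 3 (p2-g3) in gate run 42 as `HodgeCM/Model/ArchSlotDatumDefinite.lean` (verbatim).
-/
/-
Origin: speedrun cell pub-hodgecm, MODEL-CONSTRUCTION sub-cell, lineage mc-theta-3 (BINDER-OWNERS row 5, the `𝔄` slot),
seat planner-pub-hodgecm-mc-theta-3-g12-0 (gen 12), 2026-08-20.  Target in PKG: `HodgeCM/Model/ArchSlotDatumDefinite.lean`
(NEW additive leaf over vendored K-1 files only).  KERNEL only: 0 records / named facts / proof holes.
-/
import Literature.RepresentationTheory.KonnoKonno2007.JunctionVacuumDefinite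
import Literature.RepresentationTheory.KonnoKonno2007.JunctionVacuumOverlapPhase
import Literature.RepresentationTheory.KonnoKonno2007.RealUnitaryDualPairNegate
import Literature.Analysis.SegalBargmann.SchwartzCompactWeilDatum

/-!
# Slot data of the real unitary dual pair: the DOUBLY DEFINITE slot, and the rank-one slots repackaged

binder-2's census currency `placeVacExponents … (hslot : ∃ ω₁, IsArchWeilDatum (ι𝕎 P Q R S) ω₁ ∧ ∀ u, Continuous (ω₁ u))`
(`HypCensus.PlaceExponents`) consumes ONE existence statement per real place: an archimedean Weil datum of the abstract
junction `U(P,Q) × U(R,S) → Sp(𝕎)` with continuous operators.  The package supplies it when the `V`-side has real rank one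
with its lone sign on the negative block and `W` is positive definite (`isArchWeilDatum_linWeil_neg_card`, theta-1's linearised
datum; carch's `exists_isArchWeilDatum_lineSlot` is its `(Fin 2, Unit)` instance) and, through binder-2's `SmoothBlockSlot(Neg)`,
when `V` is definite and `W ≅ U(r,1)`.  This leaf adds the two remaining shapes a hermitian LINE meets:

* §1 **`exists_slotDatum_of_definite`** — BOTH spaces definite (`IsEmpty P ∨ IsEmpty Q`, `IsEmpty R ∨ IsEmpty S`): then the
  maximal compact `κ : K_V × K_W →* G_∞` is a topological group ISOMORPHISM (`κ_surjective` of `JunctionVacuumDefinite` +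
  injectivity; continuity of the inverse from compactness), and the compact pair's own Weil representation
  `dualPairWeilRep 1` (`SchwartzCompactWeilDatum`: a datum over `realifySp ∘ dualPairι = ι𝕎 ∘ κ`) transported along `κ⁻¹`
  is a datum over `ι𝕎` with continuous operators.  This is the slot at every real place of `L⁺` away from `ι₁` for the LINE
  pairs `(V, ℓ)` (there `V ≅ U(3)` and `ℓ ≅ U(1)`), and at the doubly definite places of the big pair.
* §2 **`exists_slotDatum_of_negCard`** (`[Subsingleton Q] [Nonempty R] [IsEmpty S] (p₀ q₀)`, the tree's datum with continuous
  operators, any index types) and its role-swapped twin **`exists_slotDatum_of_negCard_swap`**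
  (`[Subsingleton P] [IsEmpty R] [Nonempty S] (p₀ q₀)`, by `isArchWeilDatum_negSwap`): the slot at the place of `ι₁` for a
  line `ℓ` with `ε_ℓ · V ≅ U(2,1)` in either canonical reading.

[Folland1989, Prop. (4.39); KonnoKonno2007, §3.1 (3.1); MoeglinVignerasWaldspurger1987, Ch. 1 I.17.]  Kernel only.
-/

set_option autoImplicit false

noncomputable section

open scoped Matrix ComplexConjugate
open Literature.NumberTheory.Weil1964 Literature.Analysis.SegalBargmann
open Literature.RepresentationTheory.KonnoKonno2007 Literature.RepresentationTheory.KonnoKonno2007.RealDualPair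

namespace HodgeCM.Model.ArchSideTerm

variable {P Q R S : Type*} [Fintype P] [DecidableEq P] [Fintype Q] [DecidableEq Q] [Fintype R] [DecidableEq R]
  [Fintype S] [DecidableEq S]

/-! ## §1 Both spaces definite: `κ` is an isomorphism and the compact Weil representation is the slot datum -/

section Definite

/-- the maximal-compact inclusion `kV : U(P) × U(Q) →* U(P,Q)` is injective. [folklore] -/
theorem kV_injective : Function.Injective (UForm.kV P Q) := fun k k' hk => by
  have h1 := congrArg (fun g : UForm P Q => ((g : GL (P ⊕ Q) ℂ) : Matrix (P ⊕ Q) (P ⊕ Q) ℂ)) hk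
  simp only [UForm.coe_kV, Matrix.fromBlocks_inj] at h1
  exact Prod.ext (Subtype.ext h1.1) (Subtype.ext h1.2.2.2)

/-- `κ : K_V × K_W →* G_∞` is injective. [folklore] -/
theorem κ_injective : Function.Injective (κ P Q R S) := fun _ _ hk =>
  Prod.ext (kV_injective (congrArg Prod.fst hk)) (kV_injective (congrArg Prod.snd hk))

variable (hV : IsEmpty P ∨ IsEmpty Q) (hW : IsEmpty R ∨ IsEmpty S)

/-- **both spaces definite: `κ` is a group isomorphism `K_V × K_W ≃* G_∞`.** [Folland1989, Prop. (4.39)] -/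
def κEquiv : DPK P Q R S ≃* Ginf P Q R S :=
  MulEquiv.ofBijective (κ P Q R S) ⟨κ_injective, κ_surjective hV hW⟩

/-- (Ported verbatim from the HodgeCMPerL package; no docstring in the source.) -/
@[simp] theorem κEquiv_apply (k : DPK P Q R S) : κEquiv hV hW k = κ P Q R S k := rfl

/-- `κEquiv` is continuous. -/
theorem continuous_κEquiv : Continuous (κEquiv hV hW) := continuous_κ

/-- its inverse is continuous (a continuous bijection from a compact space to a Hausdorff space). -/
theorem continuous_κEquiv_symm : Continuous (κEquiv hV hW).symm := by
  haveI := compactSpace_matrixUnitaryGroup P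
  haveI := compactSpace_matrixUnitaryGroup Q
  haveI := compactSpace_matrixUnitaryGroup R
  haveI := compactSpace_matrixUnitaryGroup S
  exact Continuous.continuous_symm_of_equiv_compact_to_t2 (f := (κEquiv hV hW).toEquiv) (continuous_κEquiv hV hW)

/-- `ι𝕎 = (realifySp ∘ dualPairι) ∘ κ⁻¹` when both spaces are definite. [KonnoKonno2007, §3.1] -/
theorem ι𝕎_eq_comp_κEquiv_symm :
    ι𝕎 P Q R S = ((realifySp (DPIdx P Q R S)).comp dualPairι).comp (κEquiv hV hW).symm.toMonoidHom := by
  ext1 g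
  conv_lhs => rw [← (κEquiv hV hW).apply_symm_apply g]
  rw [κEquiv_apply, ι𝕎_κ]
  rfl

/-- **the slot datum at a doubly definite place**: the compact pair's Weil representation (trivial character) transported
along `κ⁻¹`. [Folland1989, Prop. (4.39)] -/
def definiteSlotRep : Representation ℂ (Ginf P Q R S) (SchwartzMap (DPIdx P Q R S → ℝ) ℂ) :=
  (dualPairWeilRep (1 : DPK P Q R S →* Circle)).comp (κEquiv hV hW).symm.toMonoidHom

/-- (Ported verbatim from the HodgeCMPerL package; no docstring in the source.) -/
theorem definiteSlotRep_apply (u : Ginf P Q R S) :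
    definiteSlotRep hV hW u = dualPairWeilRep (1 : DPK P Q R S →* Circle) ((κEquiv hV hW).symm u) := rfl

/-- it is an archimedean Weil datum over `ι𝕎`. [Folland1989, Prop. (4.39); KonnoKonno2007, §3.1] -/
theorem isArchWeilDatum_definiteSlotRep : IsArchWeilDatum (ι𝕎 P Q R S) (definiteSlotRep hV hW) := by
  rw [ι𝕎_eq_comp_κEquiv_symm hV hW]
  exact (isArchWeilDatum_dualPairWeilRep (1 : DPK P Q R S →* Circle) continuous_const).comp _
    (continuous_κEquiv_symm hV hW)

/-- its operators are continuous. -/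
theorem continuous_definiteSlotRep (u : Ginf P Q R S) : Continuous (definiteSlotRep hV hW u) := by
  show Continuous fun f => dualPairWeilRep (1 : DPK P Q R S →* Circle) ((κEquiv hV hW).symm u) f
  exact ((unitaryOpPi (dualPairι ((κEquiv hV hW).symm u))).continuous.const_smul
    ((((1 : DPK P Q R S →* Circle) ((κEquiv hV hW).symm u) : Circle) : ℂ))).congr fun f => by
      rw [Pi.smul_apply, dualPairWeilRep_apply]

/-- on the Gaussian the datum is TRIVIAL: every `u ∈ G_∞` fixes `h₀` (vacuum exponents `(0,0,0,0)`). [Folland1989, §1.7] -/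
theorem definiteSlotRep_hermitePi_zero (u : Ginf P Q R S) : definiteSlotRep hV hW u (hermitePi 0) = hermitePi 0 := by
  rw [definiteSlotRep_apply, dualPairWeilRep_hermitePi_zero, MonoidHom.one_apply, Circle.coe_one, one_smul]

include hV hW in
/-- **SLOT EXISTENCE AT A DOUBLY DEFINITE PLACE** (the shape consumed by `HypCensus.placeVacExponents`).
[Folland1989, Prop. (4.39); KonnoKonno2007, §3.1] -/
theorem exists_slotDatum_of_definite :
    ∃ ω₁ : Representation ℂ (Ginf P Q R S) (SchwartzMap (DPIdx P Q R S → ℝ) ℂ),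
      IsArchWeilDatum (ι𝕎 P Q R S) ω₁ ∧ ∀ u, Continuous (ω₁ u) :=
  ⟨definiteSlotRep hV hW, isArchWeilDatum_definiteSlotRep hV hW, continuous_definiteSlotRep hV hW⟩

end Definite

/-! ## §2 Rank-one `V`, definite `W`: the tree's linearised datum, any index types, both canonical readings -/

section RankOne

/-- **slot existence, `V ≅ U(p,1)` read with its lone sign negative, `W` positive definite** (theta-1's linearised datum
`linWeil`, vacuum exponents `(0, −|R|, 0, 0)`; operators = scalar multiples of the continuous vacuum section).
[Folland1989, §4.2 (4.24), Prop. (4.39); KonnoKonno2007, §3.1] -/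
theorem exists_slotDatum_of_negCard [Subsingleton Q] [Nonempty R] [IsEmpty S] (p₀ : P) (q₀ : Q) :
    ∃ ω₁ : Representation ℂ (Ginf P Q R S) (SchwartzMap (DPIdx P Q R S → ℝ) ℂ),
      IsArchWeilDatum (ι𝕎 P Q R S) ω₁ ∧ ∀ u, Continuous (ω₁ u) := by
  obtain ⟨ω, hω, -, hlin⟩ := isArchWeilDatum_linWeil_neg_card (P := P) (Q := Q) (R := R) (S := S) p₀ q₀
  refine ⟨ω, hω, fun g => ?_⟩
  have h1 : ∀ f, ω g f = linPhase R S q₀ (-((Fintype.card R : ℕ) : ℤ)) g •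
      vacSection (fun g : Ginf P Q R S => (⇑((ι𝕎 P Q R S g).1 :
        ((DPIdx P Q R S → ℝ) × (DPIdx P Q R S → ℝ)) ≃ₗ[ℝ] (DPIdx P Q R S → ℝ) × (DPIdx P Q R S → ℝ)) :
          PhaseMap (DPIdx P Q R S))) g f := fun f => by
    rw [hlin g, linWeil_apply]
  exact ((vacSection _ g).continuous.const_smul _).congr fun f => by simpa only [Pi.smul_apply] using (h1 f).symm

/-- **the role-swapped reading** `V ≅ U(1,q)` with its lone sign positive, `W` negative definite: the `negSwap` of §2's datum
for `(Q, P, S, R)`. [KonnoKonno2007, §3.1; MoeglinVignerasWaldspurger1987, Ch. 1 I.17] -/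
theorem exists_slotDatum_of_negCard_swap [Subsingleton P] [IsEmpty R] [Nonempty S] (p₀ : P) (q₀ : Q) :
    ∃ ω₁ : Representation ℂ (Ginf P Q R S) (SchwartzMap (DPIdx P Q R S → ℝ) ℂ),
      IsArchWeilDatum (ι𝕎 P Q R S) ω₁ ∧ ∀ u, Continuous (ω₁ u) := by
  obtain ⟨ω, hω, hc⟩ := exists_slotDatum_of_negCard (P := Q) (Q := P) (R := S) (S := R) q₀ p₀
  exact ⟨_, isArchWeilDatum_negSwap hω, continuous_negSwap_apply hc⟩

end RankOne

/-! ## §3 One dispatcher over the block shapes -/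

/-- **slot existence from the block shape alone**: doubly definite, or rank-one `V` against a definite `W` of the matching
reading. -/
theorem exists_slotDatum_of_shape
    (h : ((IsEmpty P ∨ IsEmpty Q) ∧ (IsEmpty R ∨ IsEmpty S)) ∨
      (Nonempty P ∧ Nonempty Q ∧ Subsingleton Q ∧ Nonempty R ∧ IsEmpty S) ∨
      (Nonempty P ∧ Subsingleton P ∧ Nonempty Q ∧ IsEmpty R ∧ Nonempty S)) :
    ∃ ω₁ : Representation ℂ (Ginf P Q R S) (SchwartzMap (DPIdx P Q R S → ℝ) ℂ),
      IsArchWeilDatum (ι𝕎 P Q R S) ω₁ ∧ ∀ u, Continuous (ω₁ u) := by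
  rcases h with ⟨hV, hW⟩ | ⟨⟨p₀⟩, ⟨q₀⟩, hQ, hR, hS⟩ | ⟨⟨p₀⟩, hP, ⟨q₀⟩, hR, hS⟩
  · exact exists_slotDatum_of_definite hV hW
  · exact exists_slotDatum_of_negCard p₀ q₀
  · exact exists_slotDatum_of_negCard_swap p₀ q₀

end HodgeCM.Model.ArchSideTerm

end
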